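import Summits.Parity.GeneralizedHardyLittlewood.Theorems.LeeYangFibresRelativeDimOneMoebiusSplitSingularSeriesAux2
import HarnessLib

/-!
# Crux `RelativeDimOne` (stmt-Parity-14113), line `single-moebius-split`, stub `stub_truncSingularSeries`:
# auxiliary file 3 — the general twisted one-variable Goldston–Yıldırım lemma (GTL)

`tss_gtl` (registered sub-goal): there is an absolute `c > 0` such that for all `K : ℕ`, `B ≥ 0` there is
`C` with the following property. Let `w : ℕ → ℝ` be a prime twist and `Q` a finite set of primes with
`|p w(p) − 1| ≤ K/p` for primes `p ∉ Q` and `|p w(p)| ≤ K` for `p ∈ Q`. Then for `u ≥ 2`, `|Q| ≤ B log u` and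
every `y > u`,

  `|∑_{e ≤ u} μ(e) log(u/e) ∏_{p∣e} w(p) − ∏_{p<y} (1 − w(p)) p/(p−1)| ≤ C e^{−c√log u}`.

(Goldston–Yıldırım, Integers 3 (2003) A5, Lemma 2.1 (2.11)–(2.12) is the case `w(p) = [p ∤ k]/p`, main term
`∏_{p ∣ k} p/(p−1) = k/φ(k)`; the version here, uniform in twists `p w(p) = 1 + O(1/p)` and in a thin set of
"rough" primes, is the engine of the iterated `t`-variable truncated singular series.) Proof, from the
algebraic half (`…SingularSeriesAux1`) and the Euler bounds (`…Aux2`): `Σ_w(u) = ∑_{d ≤ u} F(d) M₁(u/d)` with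
`F(d) = ∏_{p∣d}(1 − p w(p))/d` and the tree's PROVED `M₁(v) = 1 + O(e^{−c₁√log v})`
(`GreenTao2008.exists_abs_moebiusLogSum_sub_one_le`, of prime-number-theorem strength), `|M₁| ≤ C₀`; the terms
`d ≤ √u` cost `e^{−c₁√(log u/2)} ∑|F|`, the terms `d > √u` and the Euler tail (limit `J → ∞` of truncated Euler
products, `tendsto_finsetProd`) cost `u^{-1/4} ∑ |F(d)| √d`; with `|Q| ≤ B log u` the power savings absorb the
moment bounds and `c = c₁/2`.

References: D. A. Goldston, C. Y. Yıldırım, Integers 3 (2003) A5 = arXiv:math/0111212, Lemma 2.1 and §3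
[GoldstonYildirim2001]; B. Green, T. Tao, Ann. of Math. 171 (2010), App. D [GreenTao2010].
-/

noncomputable section

open Finset Real ArithmeticFunction Filter
open scoped ArithmeticFunction.Moebius Topology

namespace Summit.Parity.GeneralizedHardyLittlewood.Cruxes.RelativeDimOne.SingleMoebiusSplit

/-! ### The general twisted lemma -/

set_option maxHeartbeats 400000 in
open Literature.NumberTheory.Sieve TSSGtl in
/-- **GTL — the general twisted one-variable Goldston–Yıldırım lemma** (sub-goal `tss_gtl` of
`stub_truncSingularSeries`). There is an absolute `c > 0` such that for all `K : ℕ`, `B ≥ 0` there is `C` with: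
for every prime twist `w` and finite set of primes `Q` with `|p w(p) − 1| ≤ K/p` (`p ∉ Q`) and `|p w(p)| ≤ K`
(`p ∈ Q`), every `u ≥ 2` with `|Q| ≤ B log u` and every `y > u`,
`|∑_{e ≤ u} μ(e) log(u/e) ∏_{p∣e} w(p) − ∏_{p<y} (1 − w(p)) p/(p−1)| ≤ C e^{−c√log u}`.
(GY-I Lemma 2.1 (2.11)–(2.12) is `w = [p ∤ k]/p`, `Q` = primes of `k`, main term `k/φ(k)`.)
[cite: GoldstonYildirim2001, Lemma 2.1] -/
theorem tss_gtl : ∃ c : ℝ, 0 < c ∧ ∀ (K : ℕ) (B : ℝ), 0 ≤ B → ∃ C : ℝ, 0 ≤ C ∧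
    ∀ (w : ℕ → ℝ) (Q : Finset ℕ), (∀ p ∈ Q, p.Prime) →
      (∀ p : ℕ, p.Prime → p ∉ Q → |(p : ℝ) * w p - 1| ≤ K / p) →
      (∀ p ∈ Q, |(p : ℝ) * w p| ≤ K) →
      ∀ u : ℝ, 2 ≤ u → (Q.card : ℝ) ≤ B * Real.log u →
      ∀ y : ℕ, ⌊u⌋₊ < y →
        |(∑ e ∈ Finset.Icc 1 ⌊u⌋₊, ((ArithmeticFunction.moebius e : ℤ) : ℝ) * Real.log (u / e) *
            ∏ p ∈ e.primeFactors, w p) -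
          ∏ p ∈ Nat.primesBelow y, (1 - w p) * ((p : ℝ) / ((p : ℝ) - 1))| ≤
        C * Real.exp (-(c * Real.sqrt (Real.log u))) := by
  obtain ⟨c₁, hc₁, C₁, hC₁, hM1⟩ := GoldstonYildirimLemma21.exists_abs_moebiusLogSum_sub_one_le_of_one_le
  obtain ⟨C₀, hC₀, hM0⟩ := GreenTao2008.exists_abs_moebiusLogSum_le
  refine ⟨c₁ / 2, by positivity, fun K B hB => ?_⟩
  -- `a = c₁/√2 − c₁/2 > 0`
  have hsqrt2 : Real.sqrt 2 < 2 := by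
    rw [show (2 : ℝ) = Real.sqrt (2 ^ 2) by rw [Real.sqrt_sq (by norm_num)]]
    exact Real.sqrt_lt_sqrt (by norm_num) (by norm_num)
  have hsqrt2' : 0 < Real.sqrt 2 := Real.sqrt_pos.2 (by norm_num)
  have ha : 0 < c₁ / Real.sqrt 2 - c₁ / 2 := by
    rw [sub_pos, div_lt_div_iff₀ (by norm_num) hsqrt2']
    nlinarith
  obtain ⟨M₁', hM₁'0, hM₁'⟩ := exists_pow_mul_exp_neg_le ha (K + 1) hB
  set b : ℝ := 8 * (K + 1) * Real.sqrt B with hb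
  refine ⟨C₁ * Real.exp (2 * K) * M₁' +
    (C₀ + 2) * (Real.exp (8 * K) * Real.exp (8 * (K + 1))) * Real.exp ((b + c₁ / 2) ^ 2), by positivity, ?_⟩
  intro w Q hQp hgen hQ u hu hcard y hy
  set U := ⌊u⌋₊ with hU
  set s := Real.sqrt (Real.log u) with hs
  have hu1 : (1 : ℝ) ≤ u := by linarith
  have hu0 : (0 : ℝ) < u := by linarith
  have hlogu : 0 ≤ Real.log u := Real.log_nonneg hu1
  have hs2 : s ^ 2 = Real.log u := Real.sq_sqrt hlogu
  have hs0 : 0 ≤ s := Real.sqrt_nonneg _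
  have hUu : (U : ℝ) ≤ u := Nat.floor_le hu0.le
  have huU : u < (U : ℝ) + 1 := Nat.lt_floor_add_one u
  -- the functions `H`, `F`
  set H : ArithmeticFunction ℝ := prodPrimeFactors fun p : ℕ => (1 : ℝ) - p * w p with hH
  set F : ArithmeticFunction ℝ := H.pdiv ((ArithmeticFunction.id : ArithmeticFunction ℕ) : ArithmeticFunction ℝ)
    with hF
  have hFm : IsMultiplicative F := isMultiplicative_F hH hF
  -- Step 1: hyperbola
  have step1 : ∑ e ∈ Icc 1 U, (μ e : ℝ) * Real.log (u / e) * ∏ p ∈ e.primeFactors, w p =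
      ∑ d ∈ Icc 1 U, F d * GreenTao2008.moebiusLogSum (u / d) := by
    rw [hU, tss_hyperbola w u]
    exact Finset.sum_congr rfl fun d _ => by rw [F_apply hF]
  -- moment bounds
  set Ab : ℝ := Real.exp (2 * K) * ((Q.card : ℝ) + 1) ^ (K + 1) with hAb
  set Zb : ℝ := Real.exp (8 * K) * Real.exp (8 * (K + 1) * Real.sqrt (Q.card + 1)) with hZb
  have hprime : ∀ {z : ℕ}, ∀ p ∈ Nat.primesBelow z, p.Prime := fun p hp => (Nat.mem_primesBelow.1 hp).2
  have hA : ∑ d ∈ Icc 1 U, |F d| ≤ Ab := by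
    refine (sum_abs_F_le hFm U).trans ((Finset.prod_le_prod (fun p _ => Finset.sum_nonneg fun _ _ =>
      abs_nonneg _) fun p hp => sum_abs_F_prime_pow_le hH hF (hprime p hp) U).trans ?_)
    exact prod_one_add_abs_div_le hQp hgen hQ _ hprime
  have hZ : ∀ z J : ℕ, ∏ p ∈ Nat.primesBelow z, ∑ j ∈ Finset.range (J + 1), |F (p ^ j)| *
      Real.sqrt ((p ^ j : ℕ) : ℝ) ≤ Zb := fun z J =>
    (Finset.prod_le_prod (fun p _ => Finset.sum_nonneg fun _ _ => by positivity)
      fun p hp => sum_absSqrt_F_prime_pow_le hH hF (hprime p hp) J).trans (prod_one_add_abs_rpow_le hQp hgen hQ z)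
  have hZ' : ∑ d ∈ Icc 1 U, |F d| * Real.sqrt d ≤ Zb := (sum_absSqrt_F_le hFm U).trans (hZ (U + 1) U)
  have hAb0 : 0 ≤ Ab := by positivity
  have hZb0 : 0 ≤ Zb := by positivity
  -- Step 2: Euler truncation of the main term (limit `J → ∞` of the truncated Euler products)
  have step2 : |∑ d ∈ Icc 1 U, F d - ∏ p ∈ Nat.primesBelow y, (1 - w p) * ((p : ℝ) / ((p : ℝ) - 1))| ≤
      (Real.sqrt (U + 1))⁻¹ * Zb := by
    have hlim : Tendsto (fun J => ∏ p ∈ Nat.primesBelow y, ∑ j ∈ Finset.range (J + 1), F (p ^ j)) atTop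
        (𝓝 (∏ p ∈ Nat.primesBelow y, (1 - w p) * ((p : ℝ) / ((p : ℝ) - 1)))) :=
      tendsto_finsetProd _ fun p hp => tendsto_sum_F_prime_pow hH hF (hprime p hp)
    have hlim2 : Tendsto (fun J => |∑ d ∈ Icc 1 U, F d -
        ∏ p ∈ Nat.primesBelow y, ∑ j ∈ Finset.range (J + 1), F (p ^ j)|) atTop
        (𝓝 |∑ d ∈ Icc 1 U, F d - ∏ p ∈ Nat.primesBelow y, (1 - w p) * ((p : ℝ) / ((p : ℝ) - 1))|) :=
      (continuous_abs.tendsto _).comp (tendsto_const_nhds.sub hlim)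
    refine le_of_tendsto hlim2 (Filter.eventually_atTop.2 ⟨U, fun J hJ => ?_⟩)
    exact (abs_sum_F_sub_prod_le hFm U y J hy hJ).trans
      (mul_le_mul_of_nonneg_left (hZ y J) (inv_nonneg.2 (Real.sqrt_nonneg _)))
  -- Step 3: the `M₁` part
  have step3 : |∑ d ∈ Icc 1 U, F d * GreenTao2008.moebiusLogSum (u / d) - ∑ d ∈ Icc 1 U, F d| ≤
      C₁ * Real.exp (-(c₁ * Real.sqrt (Real.log u / 2))) * Ab + (C₀ + 1) * u ^ (-(1 / 4 : ℝ)) * Zb := by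
    rw [← Finset.sum_sub_distrib]
    have key : ∀ d ∈ Icc 1 U, |F d * GreenTao2008.moebiusLogSum (u / d) - F d| ≤
        C₁ * Real.exp (-(c₁ * Real.sqrt (Real.log u / 2))) * |F d| +
          (C₀ + 1) * u ^ (-(1 / 4 : ℝ)) * (|F d| * Real.sqrt d) := by
      intro d hd
      obtain ⟨hd1, hdU⟩ := Finset.mem_Icc.1 hd
      have hd0 : (0 : ℝ) < d := by exact_mod_cast hd1
      have hdu : (d : ℝ) ≤ u := le_trans (by exact_mod_cast hdU) hUu
      rw [← mul_sub_one, abs_mul]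
      have h2nonneg : 0 ≤ (C₀ + 1) * u ^ (-(1 / 4 : ℝ)) * (|F d| * Real.sqrt d) := by positivity
      have h1nonneg : 0 ≤ C₁ * Real.exp (-(c₁ * Real.sqrt (Real.log u / 2))) * |F d| := by positivity
      rcases le_or_gt ((d : ℝ) ^ 2) u with hsmall | hlarge
      · -- `d ≤ √u`: use `M₁(u/d) = 1 + O(e^{-c₁√log(u/d)})` and `log(u/d) ≥ log u / 2`
        have hud : 1 ≤ u / d := by rw [le_div_iff₀ hd0, one_mul]; exact hdu
        have hM := hM1 (u / d) hud
        have hlog : Real.log u / 2 ≤ Real.log (u / d) := by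
          rw [Real.log_div hu0.ne' hd0.ne']
          have hlog2 : Real.log ((d : ℝ) ^ 2) = 2 * Real.log d := by
            rw [Real.log_pow]; push_cast; ring
          have : 2 * Real.log d ≤ Real.log u := by
            rw [← hlog2]; exact Real.log_le_log (by positivity) hsmall
          linarith
        have hexp : Real.exp (-(c₁ * Real.sqrt (Real.log (u / d)))) ≤
            Real.exp (-(c₁ * Real.sqrt (Real.log u / 2))) := by
          apply Real.exp_le_exp.2
          have := Real.sqrt_le_sqrt hlog
          nlinarith
        calc |F d| * |GreenTao2008.moebiusLogSum (u / d) - 1|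
            ≤ |F d| * (C₁ * Real.exp (-(c₁ * Real.sqrt (Real.log u / 2)))) :=
              mul_le_mul_of_nonneg_left (hM.trans (mul_le_mul_of_nonneg_left hexp hC₁)) (abs_nonneg _)
          _ = C₁ * Real.exp (-(c₁ * Real.sqrt (Real.log u / 2))) * |F d| := by ring
          _ ≤ _ := le_add_of_nonneg_right h2nonneg
      · -- `d > √u`: `|M₁ − 1| ≤ C₀ + 1 ≤ (C₀ + 1) u^{-1/4} √d`
        have hM : |GreenTao2008.moebiusLogSum (u / d) - 1| ≤ C₀ + 1 :=
          (abs_sub _ _).trans (add_le_add (hM0 _) (by rw [abs_one]))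
        have hroot : 1 ≤ u ^ (-(1 / 4 : ℝ)) * Real.sqrt d := by
          rw [Real.rpow_neg hu0.le, Real.sqrt_eq_rpow, inv_mul_eq_div, one_le_div (by positivity)]
          have h1 : u ^ (1 / 4 : ℝ) = (u ^ (1 / 2 : ℝ)) ^ (1 / 2 : ℝ) := by
            rw [← Real.rpow_mul hu0.le]; norm_num
          rw [h1]
          refine Real.rpow_le_rpow (by positivity) ?_ (by norm_num)
          rw [← Real.sqrt_eq_rpow]
          exact Real.sqrt_le_left (by linarith) |>.2 hlarge.le
        calc |F d| * |GreenTao2008.moebiusLogSum (u / d) - 1| ≤ |F d| * (C₀ + 1) :=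
              mul_le_mul_of_nonneg_left hM (abs_nonneg _)
          _ ≤ |F d| * (C₀ + 1) * (u ^ (-(1 / 4 : ℝ)) * Real.sqrt d) :=
              le_mul_of_one_le_right (by positivity) hroot
          _ = (C₀ + 1) * u ^ (-(1 / 4 : ℝ)) * (|F d| * Real.sqrt d) := by ring
          _ ≤ _ := le_add_of_nonneg_left h1nonneg
    calc |∑ d ∈ Icc 1 U, (F d * GreenTao2008.moebiusLogSum (u / d) - F d)|
        ≤ ∑ d ∈ Icc 1 U, |F d * GreenTao2008.moebiusLogSum (u / d) - F d| := Finset.abs_sum_le_sum_abs _ _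
      _ ≤ ∑ d ∈ Icc 1 U, (C₁ * Real.exp (-(c₁ * Real.sqrt (Real.log u / 2))) * |F d| +
            (C₀ + 1) * u ^ (-(1 / 4 : ℝ)) * (|F d| * Real.sqrt d)) := Finset.sum_le_sum key
      _ = C₁ * Real.exp (-(c₁ * Real.sqrt (Real.log u / 2))) * ∑ d ∈ Icc 1 U, |F d| +
            (C₀ + 1) * u ^ (-(1 / 4 : ℝ)) * ∑ d ∈ Icc 1 U, |F d| * Real.sqrt d := by
          rw [Finset.sum_add_distrib, Finset.mul_sum, Finset.mul_sum]
      _ ≤ _ := by gcongr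
  -- Step 4: assembly and absorption of the constants
  have hexp1 : Real.exp (-(c₁ * Real.sqrt (Real.log u / 2))) =
      Real.exp (-((c₁ / Real.sqrt 2 - c₁ / 2) * s)) * Real.exp (-(c₁ / 2 * s)) := by
    rw [← Real.exp_add, Real.sqrt_div hlogu, ← hs]
    congr 1
    field_simp
    ring
  have hu14 : u ^ (-(1 / 4 : ℝ)) = Real.exp (-(s ^ 2 / 4)) := by
    rw [Real.rpow_def_of_pos hu0, hs2]; congr 1; ring
  have hUinv : (Real.sqrt (U + 1))⁻¹ ≤ Real.exp (-(s ^ 2 / 4)) := by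
    rw [← hu14, Real.rpow_neg hu0.le]
    refine inv_anti₀ (Real.rpow_pos_of_pos hu0 _) ?_
    calc u ^ (1 / 4 : ℝ) ≤ u ^ (1 / 2 : ℝ) := Real.rpow_le_rpow_of_exponent_le hu1 (by norm_num)
      _ = Real.sqrt u := (Real.sqrt_eq_rpow u).symm
      _ ≤ Real.sqrt (U + 1) := Real.sqrt_le_sqrt huU.le
  have hq : (Q.card : ℝ) + 1 ≤ B * s ^ 2 + 1 := by rw [hs2]; linarith
  have hq0 : (0 : ℝ) ≤ Q.card := Nat.cast_nonneg _
  -- piece 1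
  have hpiece1 : C₁ * Real.exp (-(c₁ * Real.sqrt (Real.log u / 2))) * Ab ≤
      C₁ * Real.exp (2 * K) * M₁' * Real.exp (-(c₁ / 2 * s)) := by
    rw [hexp1, hAb]
    have h1 : ((Q.card : ℝ) + 1) ^ (K + 1) * Real.exp (-((c₁ / Real.sqrt 2 - c₁ / 2) * s)) ≤ M₁' :=
      le_trans (mul_le_mul_of_nonneg_right (pow_le_pow_left₀ (by positivity) hq _) (Real.exp_pos _).le)
        (hM₁' s hs0)
    calc C₁ * (Real.exp (-((c₁ / Real.sqrt 2 - c₁ / 2) * s)) * Real.exp (-(c₁ / 2 * s))) *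
          (Real.exp (2 * K) * ((Q.card : ℝ) + 1) ^ (K + 1))
        = C₁ * Real.exp (2 * K) * (((Q.card : ℝ) + 1) ^ (K + 1) *
            Real.exp (-((c₁ / Real.sqrt 2 - c₁ / 2) * s))) * Real.exp (-(c₁ / 2 * s)) := by ring
      _ ≤ _ := by gcongr
  -- piece 2
  have hsqrtq : Real.sqrt (Q.card + 1) ≤ Real.sqrt B * s + 1 := by
    calc Real.sqrt (Q.card + 1) ≤ Real.sqrt (B * s ^ 2 + 1) := Real.sqrt_le_sqrt hq
      _ ≤ Real.sqrt B * s + 1 := by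
          rw [Real.sqrt_le_left (by positivity)]
          have hB' : Real.sqrt B ^ 2 = B := Real.sq_sqrt hB
          nlinarith [Real.sqrt_nonneg B]
  have hZb' : Zb ≤ Real.exp (8 * K) * Real.exp (8 * (K + 1)) * Real.exp (b * s) := by
    rw [hZb, mul_assoc (Real.exp (8 * K)), ← Real.exp_add (8 * (K + 1)) (b * s)]
    refine mul_le_mul_of_nonneg_left (Real.exp_le_exp.2 ?_) (Real.exp_pos _).le
    rw [hb]
    have hK1 : (0 : ℝ) ≤ 8 * (K + 1) := by positivity
    have h1 := mul_le_mul_of_nonneg_left hsqrtq hK1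
    have h2 : 8 * ((K : ℝ) + 1) * (Real.sqrt B * s + 1) = 8 * (K + 1) + 8 * (K + 1) * Real.sqrt B * s := by ring
    linarith
  have hpiece2 : (C₀ + 2) * Real.exp (-(s ^ 2 / 4)) * Zb ≤
      (C₀ + 2) * (Real.exp (8 * K) * Real.exp (8 * (K + 1))) * Real.exp ((b + c₁ / 2) ^ 2) *
        Real.exp (-(c₁ / 2 * s)) := by
    have hsq := exp_neg_sq_mul_exp_le b (c₁ / 2) s
    calc (C₀ + 2) * Real.exp (-(s ^ 2 / 4)) * Zb
        ≤ (C₀ + 2) * Real.exp (-(s ^ 2 / 4)) * (Real.exp (8 * K) * Real.exp (8 * (K + 1)) * Real.exp (b * s)) :=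
          mul_le_mul_of_nonneg_left hZb' (by positivity)
      _ = (C₀ + 2) * (Real.exp (8 * K) * Real.exp (8 * (K + 1))) * (Real.exp (-(s ^ 2 / 4)) * Real.exp (b * s)) := by
          ring
      _ ≤ (C₀ + 2) * (Real.exp (8 * K) * Real.exp (8 * (K + 1))) * (Real.exp ((b + c₁ / 2) ^ 2) *
            Real.exp (-(c₁ / 2 * s))) := mul_le_mul_of_nonneg_left hsq (by positivity)
      _ = _ := by ring
  -- conclusion
  rw [step1]
  calc |∑ d ∈ Icc 1 U, F d * GreenTao2008.moebiusLogSum (u / d) -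
        ∏ p ∈ Nat.primesBelow y, (1 - w p) * ((p : ℝ) / ((p : ℝ) - 1))|
      ≤ |∑ d ∈ Icc 1 U, F d * GreenTao2008.moebiusLogSum (u / d) - ∑ d ∈ Icc 1 U, F d| +
          |∑ d ∈ Icc 1 U, F d - ∏ p ∈ Nat.primesBelow y, (1 - w p) * ((p : ℝ) / ((p : ℝ) - 1))| :=
        abs_sub_le _ _ _
    _ ≤ C₁ * Real.exp (-(c₁ * Real.sqrt (Real.log u / 2))) * Ab + (C₀ + 1) * u ^ (-(1 / 4 : ℝ)) * Zb +
          (Real.sqrt (U + 1))⁻¹ * Zb := add_le_add step3 step2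
    _ ≤ C₁ * Real.exp (-(c₁ * Real.sqrt (Real.log u / 2))) * Ab + (C₀ + 1) * Real.exp (-(s ^ 2 / 4)) * Zb +
          Real.exp (-(s ^ 2 / 4)) * Zb := by rw [hu14]; gcongr
    _ = C₁ * Real.exp (-(c₁ * Real.sqrt (Real.log u / 2))) * Ab + (C₀ + 2) * Real.exp (-(s ^ 2 / 4)) * Zb := by
        ring
    _ ≤ C₁ * Real.exp (2 * K) * M₁' * Real.exp (-(c₁ / 2 * s)) +
          (C₀ + 2) * (Real.exp (8 * K) * Real.exp (8 * (K + 1))) * Real.exp ((b + c₁ / 2) ^ 2) *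
            Real.exp (-(c₁ / 2 * s)) := add_le_add hpiece1 hpiece2
    _ = _ := by ring

end Summit.Parity.GeneralizedHardyLittlewood.Cruxes.RelativeDimOne.SingleMoebiusSplit

end
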